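import Summits.AtomisticToContinuum.HydrodynamicLimit.Theses.MourreKoopmanCharges
import Summits.AtomisticToContinuum.HydrodynamicLimit.Theses.BallwiseInvariantReferences
import Summits.AtomisticToContinuum.HydrodynamicLimit.Theses.TwoClocks
import Summits.AtomisticToContinuum.HydrodynamicLimit.Theorems.ImplosionDichotomyHydroLimitInBandOfHeart
import Summits.AtomisticToContinuum.HydrodynamicLimit.Theorems.ImplosionDichotomyHydroLimitInBandSplit
import Summits.AtomisticToContinuum.HydrodynamicLimit.Theorems.MourreKoopmanChargesLinearToEntropyInBandDefs
import Summits.AtomisticToContinuum.HydrodynamicLimit.Theorems.MourreKoopmanChargesLinearToEntropyInBandDock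
import Summits.AtomisticToContinuum.HydrodynamicLimit.Theorems.MourreKoopmanChargesLinearToEntropyInBandLedgerGlue
import Summits.AtomisticToContinuum.HydrodynamicLimit.Theorems.MourreKoopmanChargesLinearToEntropyInBandHeartGlue
import Summits.AtomisticToContinuum.HydrodynamicLimit.Theorems.MourreKoopmanChargesLinearToEntropyInBandFastCollisionThroughputInBand
import Summits.AtomisticToContinuum.HydrodynamicLimit.Theorems.MourreKoopmanChargesLinearToEntropyInBandContinuityOfEnvelope
import Summits.AtomisticToContinuum.HydrodynamicLimit.Theses.BGEndpointRigidity
import Summits.AtomisticToContinuum.HydrodynamicLimit.Theorems.MourreKoopmanChargesLinearToEntropyInBandDefsB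
import Summits.AtomisticToContinuum.HydrodynamicLimit.Theorems.MourreKoopmanChargesLinearToEntropyInBandDefsC
import Summits.AtomisticToContinuum.HydrodynamicLimit.Theorems.MourreKoopmanChargesLinearToEntropyInBandThroughputOfEnvelope

/-!
# Skeleton v8 (lead c5, wave 3 of 2026-08-17; v5–v7 lead c4, v1–v4 lead c3) for crux `LinearToEntropyInBand` — stmt-AtomisticToContinuum-17740
route-AtomisticToContinuum-MourreKoopmanCharges (sub-problem HydrodynamicLimit), crux #6 (rank 6):
`LinearToEntropyInBand := OneBodyCompleteness → StressStrongMixing → <body of RelEntropyVanishingInBand>`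
— THE NONLINEAR BRIDGE, packing-guarded (1:1 restatement of LinearToEntropy stmt-9585 after the
Statement re-type p126922).

LINE = the route header's own two-layer plan for this node, `LinearToEntropyInBand ⇐
(local flux-Gibbsianity) → BallwiseSufficiency(∧ tails)` (card local-flux-gibbsianity-ballwise), with
every solution-side statement carrying the Statement's packing guard `∀ t ∈ [0,T) ∀ x, ρ_t(x)σ³ < η`.

## History (v1 → v4: lead c3; v5 → v7: lead c4; v8: lead c5)

* v1 (planner-skel, sha 8d9a032b…): stubs 1 and 4 named `BallwiseInvariantReferences.LocalFluxGibbsianity`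
  (stmt-13021) verbatim — refuted-MISSTATED on paper three times (rattack-13021-0/g2, rreview-0815T18-35:
  macroscopic near-jammed clusters earn collisional virial `≈ 3β₀θ/α'` per particle at Gibbs cost
  `3 log(1/α') + 3 log(1/σ') + O(1)`, so the pressure is `+∞` for all `σ₀, β₀, K, L, k`).
* v2–v4 (lead c3, sha e4b038c3…): stubs 1/4 re-typed against VISIBLE local flux-Gibbsianity
  `VisibleFluxGibbsianity := PressureVanishesR (fun R => pressureOf (visExponent R))` (planner-skel-13021's
  `stub_visibleWindowPressure`: the 13021 functional restricted to slow AND mesoscopically dilute particles, the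
  scale `R` quantified with `K` before the window `L`; both recorded witnesses miss it); objects landed as
  `Theorems/MourreKoopmanChargesLinearToEntropyInBandDefs.lean` (p146669); stub 4 sharpened to Yau's INTEGRATED
  one-window entropy ledger `ClampedCurrentsDockFromWindows.LedgerIntegratedCoreInBand`, the running-supremum
  Grönwall S2 and the dock S1 PROVED (`…Dock.lean`, p148932); linear rungs of stub 1 landed (9583 ⟹ 9531 p151468,
  9583 ⟹ 9532 p151895, 9584 ⟹ 9531 p152202).
* **v5 (lead c4, this file; wave 2 of 2026-08-17).**  Every LANDED piece of the Yau machinery leaves the open stubs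
  once more, and the blocking heads of the truncation inputs are recorded BY NAME in the tree:
  - stub 2 `stub_energyCurrentTailsInBand` (ECT in band): blocked on the 9235 heads `FirstPartnerFloorMeso` (T′),
    `FirstPartnerRealisedShare` (I′), `JeansLoadedDice.ContactIntensityDominationOneRare` (stmt-16939); by-name glue
    `LTEInBand.glue_energyCurrentTailsInBand_of_firstPartner / _of_mixingFloor4L` LANDED (p154496); the guard buys
    nothing along any landed chain (no head mentions `ρ_t`).
  - stub 3 `stub_fastCollisionThroughputInBand` (FCT in band): blocked on `BGEndpointRigidity.LanfordEnvelopeR`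
    (stmt-13677) ALONE — by-name reductions `glue_fastCollisionThroughput_of_lanfordEnvelopeR : LanfordEnvelopeR →
    BallwiseInvariantReferences.FastCollisionThroughput` (13677 ⟹ 13022, p155741) and
    `glue_fastCollisionThroughputInBand_of_lanfordEnvelopeR` (p156573) LANDED; the constant-profile case is PROVED
    outright (`LTEInBand.fastCollisionThroughput_const`, p156573).
  - stub 4 (v4 `stub_ballwiseLedgerVisibleInBand : ∀ η>0, VLFG → ECT(η) → FCT(η) → LedgerIntegratedCoreInBand`) is
    SPLIT along the landed summation `ClampedCurrentsDockFromWindows.stub_ledgerFromWindowsS` (+ a-priori bound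
    `EntropyClockDock.ledgerAprioriBound`), the landed static clause `HydroLimitInBandHeart.stub_staticClause` and the
    landed guarded window continuity `LTEInBand.glue_windowContinuityInBandBelow_of_tails` (p154880, from CAT, CEAT
    and the GUARDED ECT(η)):
      stub 4a `stub_windowClauseVisibleInBand : ∀ η>0, VLFG → ECT(η) → FCT(η) → HydroLimitInBandHeart.WindowClauseInBand`
        — Yau's ONE-WINDOW ENTROPY INEQUALITY IN THE BAND from visible flux-Gibbsianity (the line's ball-wise
        one-block estimate proper; XL, open);
      stub 4b `stub_transferActivityTails : TwoClocks.TransferActivityTails` (stmt-16624, BY NAME; it gives CAT 13734 ∧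
        CEAT by the landed `HydroLimitInBandHeart.activityTails_of_transferActivityTails`) — the only place the
        transfer-activity tails enter is the window continuity;
    with PROVED glue S3 `stub_oneWindowLedgerStaticOfWindowClause` (static clause out) and S4
    `stub_ballwiseLedgerOfPieces` (= `LTEInBand.glue_ballwiseLedger_of_static_of_activityTails`, landed p154880).
  Stubs open after v5: 1 (lead), 2 [9235 heads], 3 [13677], 4a (XL), 4b [16624].
* **v6 (lead c4, this file; wave 3 of 2026-08-17).**  (i) RUNG LANDED toward stub 1: `LTEInBand.stub_oneBodyCompletenessGalilean`
  (`OneBodyCompleteness` is Galilean-covariant: the drift-`u` form of 9583, p158715 + p159187; the drift gap of stub 1 is closed).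
  (ii) CONSOLIDATION LANDED: the guarded window continuity follows from `BGEndpointRigidity.LanfordEnvelopeR` (stmt-13677) + the
  guarded ECT (`glue_windowContinuityInBandBelow_of_lanfordEnvelopeR`, `glue_ballwiseLedger_of_static_of_lanfordEnvelopeR`,
  p158163 + p158600), so v5's by-name stub 4b `TwoClocks.TransferActivityTails` (16624) is REPLACED by the by-name stub
  `stub_lanfordEnvelopeR` (13677), which ALSO yields stub 3 (`glue_fastCollisionThroughputInBand_of_lanfordEnvelopeR`, p156573):
  v5's stub 3 leaves the skeleton (FCT in band is now DERIVED, at the level handed over by 13677).  (iii) The wave-3 ARCHITECTURE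
  AUDIT of 4a (work/stubs/w3/AUDIT-4a.md, attached as evidence) found two antecedent mismatches of v5's 4a: the INTEGRATED
  `FastCollisionThroughputBelow η` cannot serve the PER-WINDOW clause (off by `(N+1)^{1/3}/τ`) and misses the slow-but-dense
  collisions `visCore` drops; and the collision-kernel time-freeze needs a per-window `L¹` activity bound.  Both are supplied
  by the Lanford envelope (fast part as in p155741; mean window activity as in p158163), so 4a is RE-TYPED with
  `LanfordEnvelopeR` in place of `FastCollisionThroughputBelow η`.  The audit's finer split of 4a (4a-i `VLFG →
  VisibleOneBlockEstimateInBand` = THE ball-wise localisation, entirely unbuilt, to be posed in `L¹`/splice form and NEVER at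
  pressure level — the exponential-scale block↔torus comparison is paper-level false; 4a-ii Yau bookkeeping with the
  visible/invisible split + `MesoscopicBlockLD` statics; 4a-iii `LanfordEnvelopeR → InvisibleCollisionThroughputInBand ∧
  MeanWindowActivityInBand`) needs new typed objects (`visCoreN`, …) and is recorded for the next reshape, not registered.
  Stubs open after v6: 1 `stub_visibleFluxGibbsianity` (lead, XL), 2 `stub_energyCurrentTailsInBand` [9235 heads],
  L `stub_lanfordEnvelopeR` [13677 by name], 4a `stub_windowClauseVisibleInBand` (XL) — FOUR; external named inputs = {9235, 13677}.
* **v7 (lead c4, this file; waves 4–5 of 2026-08-17).**  The objects of the audit's decomposition of 4a are TYPED and LANDED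
  (`Theorems/MourreKoopmanChargesLinearToEntropyInBandDefsB.lean`, p161297: `InvisibleCollisionThroughputW/InBand`,
  `FastCollisionThroughputW`, `MeanWindowTransferActivityBelow`, `VisibleN`, `visDensityN/visMomentumN/visEnergyN`, `visCoreN`,
  `VisibleOneBlockEstimateInBand`, `MesoscopicBlockLD`, bookkeeping `stub_objectsV7`), and what the Lanford envelope delivers PER
  WINDOW is PROVED: 4a-iii `stub_throughputOfEnvelopeR : ∀ η>0, LanfordEnvelopeR → FastCollisionThroughputW η ∧
  MeanWindowTransferActivityBelow η` (p160336 fast half, p162149 mean half).  v6's XL stub 4a is accordingly SPLIT into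
    4a-i  `stub_visibleOneBlockEstimateInBand : VisibleFluxGibbsianity → VisibleOneBlockEstimateInBand` — THE ball-wise
          localisation (XL, entirely unbuilt; to be proved in `L¹`/splice form, never at pressure level);
    4a-ii `stub_windowClauseOfOneBlockInBand : ∀ η>0, VisibleOneBlockEstimateInBand → EnergyCurrentTailsBelow η →
          InvisibleCollisionThroughputW η → MeanWindowTransferActivityBelow η → HydroLimitInBandOfHeart.CoherentSuprathermalContentVanishesW
          → WindowClauseInBand` — Yau's bookkeeping with the visible/invisible split (L–XL; needs inside the TRUE-grade statics
          `MesoscopicBlockLD`, typed in DefsB and registered as the helper target `stub_mesoscopicBlockLD`);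
    I     `stub_invisibleCollisionThroughputInBand : InvisibleCollisionThroughputInBand` — NEW bare true-law input (per-window
          throughput of collisions with a fast OR mesoscopically dense endpoint; its fast half follows from the envelope, its dense
          half does not — objects worker's correction of AUDIT §4);
    C     `stub_coherentSuprathermalContentW : HydroLimitInBandOfHeart.CoherentSuprathermalContentVanishesW` — BY NAME, the 9133
          heart's weighted coherence input (cubic-in-velocity terms are not entropy-priceable at an `O(1)` rate — HighMomentumCutoff —
          objects worker's caveat 2);
  with the PROVED glue S5 `stub_windowClauseVisibleInBandOfPieces` recovering v6's 4a statement (descent to `min η ηI` by the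
  antitonicity of ECT and ICT).  Stubs open after v7 (SEVEN = stubs_max): own XL/L {1, 4a-i, 4a-ii}; by-name / bare open inputs
  {2 [9235 heads], L [13677], I [new, unstaffed], C [CSCV-W, 9133's input]}.  `sorry` occurs ONLY inside the seven open `stub_*`.
  PLANNER SIGNAL: with v7 the line's Yau step needs nearly the same true-law inputs as the OneFlightGossipEngine heart (ECT, the
  envelope ⊇ CAT/CEAT's `L¹` content, CSCV-W) PLUS its own {VLFG, the localisation 4a-i, the dense throughput I, mesoscopic statics};
  it beats PATH B only if VLFG + 4a-i are easier than KCWF + LCTF.  4a-i is crux-sized (promote-stub candidate).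
* **v8 (lead c5, this file; wave 3 of 2026-08-17, seven workers, 7 accepted `--supports` files p167422 p168090 p168165 p168217
  p168720 p168726 p169208 + objects part C).**  (i) Stub 4a-ii was MIS-STATED (worker audit, `WINDOWCLAUSE-PLAN.md` in the lead's
  folder, pieces LANDED as `stub_windowClausePieces` p168720 — visible/invisible split `abs_sum_invisible_le`, collision coverage
  `ict_indicator_of_not_visible_pair` + `dropped_kernel_le_ict_integrand` (`K_ICT = K − sup‖u‖`, `5/4 < 3/2`), the visible channel
  `visibleChannel_expectation` — and `stub_windowClausePricing` p168726 — entropy pricing of the dense content and of the block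
  fluctuation by `MesoscopicBlockLD` (ii)/(i) at rates `lam₀⁻¹, a₀⁻¹`): the suprathermal CUBIC streaming content of the
  slow-but-`R`-dense particles that `visCoreN` drops (and the energy-direction cross terms of the block Euler remainder) is
  entropy-priceable only at rate `≲ 1/(2θK)`, a Grönwall coefficient growing with the visibility cut `K` that `WindowClauseInBand`
  fixes BEFORE `ε`; ECT sees only speeds above `M(ε)`, CSCV-W only time-coherent particles, ICT/MWTA are collision-weighted.  The
  corrected 4a-ii takes a SIXTH antecedent, the per-time kinetic dense content `DenseKineticContentW η` (objects part C,
  `…DefsC.lean`: `E_P[(N+1)⁻¹Σᵢ 𝟙{dense_(5/4),R}(1+‖vᵢ‖²)] ≤ η'`, `∃R₀ ∀R ∃N₀ ∀N ∀s`), with which both become `ε`-terms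
  (`Σ_dense‖W‖³𝟙{≤K} ≤ KΣ_dense(1+‖W‖²)`, `R₀` after `K`); the collision side (d) and the test-field time grid (c) CLOSE as typed.
  (ii) Stub I's typing was audited (worker report: the a-priori form is of conclusion strength as an input; the Grönwall form
  `DenseTransferThroughputGInBand` is derivable from `TwoClocks.TransferActivityTails` + a CLAMPED dense-activity window LD under the
  reference — the unclamped LD is paper-false by sustained jammed clumps; glue `glue_invisibleThroughput_of_fast_and_dense` LANDED
  p168090, fast half from the envelope); v8 KEEPS the a-priori form, which the landed 4a-ii pieces consume, and registers the two
  "no mesoscopic clustering before the shock" inputs — collision-weighted (I) and kinetic (D) — as ONE stub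
  `stub_noMesoscopicClusteringInBand : InvisibleCollisionThroughputInBand ∧ DenseKineticContentInBand` (same grade, same mechanism;
  for the planner to file as one or two true-law items), keeping seven open stubs.  (iii) 4a-i SIZED (worker memo
  `VOBE-DECOMPOSITION.md`: ≥ 10 sessions — items 0+1 ball contents/splice, 2 ball-marginal subadditivity with Poissonisation and
  hard-core interface, 3 frozen-reference mismatch + canonical free-energy expansion, 4 = macroscopic-collar influence locality MCIL
  under the INVARIANT canonical laws at every fixed amplitude, assembly; cores LANDED: `stub_ballMarginalsProductCore` p168165,
  `stub_spliceCore` p169208; no missing antecedent — locality transfers through the invariant laws, not through the envelope):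
  crux-sized, PROMOTE (split A BallMarginalStatics / B MCIL / C SpliceAssembly).  (iv) `MesoscopicBlockLD` reduced to its
  position-only core (`glue_mesoscopicBlockLD_of_pos` p168217: clause (i) under the flow-free measure ∧ (ii-pos); velocity
  integration `lintegral_exp_mul_sum_ite_quadratic_le`; junk audit clean: the reference density IS `ρ₀` by
  `EntropyClockDock.activity_of_density`).  (v) By-name stubs re-audited: 2 ↦ 9235's typed split children 18198/18199/18200
  (glue p167422); L ↦ 13677 unchanged (all consumers use only the PAIR conjunct `s = 2` of the envelope — reshape information);
  C ↦ CSCV-W is owned by NO item (planner: file it).  Stubs open after v8 (SEVEN): {1 VLFG [lead], 2 [9235 children], L [13677],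
  4a-i [PROMOTE], 4a-ii corrected [L–XL], I∧D [bare true-law inputs], C [CSCV-W, unowned]}.
  Waves 4–5 (lead c5, same session; 9 more accepted files): toward 4a-ii — M2 `stub_windowClauseExponent` p169879, M3
  `stub_windowClauseCollisionalId` p170126 (signature CORRECTED: `¬ IsIncoming`), M4a `stub_windowClauseFrozenSplit` p170246 (hypotheses
  corrected), Euler structure of the entropy variables p170934 + Cst defect p170940, covering p171178 (the plan's SHARP cap-removal form is
  FALSE — FCC array of visible micro-clusters gives block density 2.22ρ_s —, crude `visDensityN ≤ 3(8+R/k)³ρmax` landed; the EOS cap stays),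
  window-Fubini p171037; toward 4a-i — `BallContentDefs` p169961 + `stub_ballContentSplice` p170213 (items 0+1 of the sizing memo CLOSED;
  MCIL typed refuter-grade in the lead's `work/stubs/MCIL_typing.lean`).  Remaining of 4a-ii (XL composition): FREEZE∘`frozen_split`∘per-term
  pricing∘`window_bookkeeping`, cone-smoothing commutator, second-order Taylor bound of the CAPPED tested flux, quasi-static block
  coefficients + CSCV-W step for `(ē−e)·δm̃_{>K⋆}`, re-typed statics `MesoscopicBlockLD` (i)∧(i′) ((ii) is idle in the corrected chain).
-/

noncomputable section

namespace Summit.AtomisticToContinuum.HydrodynamicLimit.Cruxes.LinearToEntropyInBand.Birth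

open scoped BigOperators Topology Classical MeasureTheory ProbabilityTheory InnerProductSpace
open Filter Set Function MeasureTheory
open Summit.AtomisticToContinuum.HydrodynamicLimit.Theses

/-! ## Vocabulary
The guarded truncation inputs `EnergyCurrentTailsBelow/InBand`, `FastCollisionThroughputBelow/InBand` (with
`energyCurrentTailsBelow_antitone`, `fastCollisionThroughputBelow_antitone`, `…_of_unguarded`) and the visible-LFG
vocabulary `Cfg … PressureVanishesR`, `VisibleFluxGibbsianity` are the LANDED objects module
`Theorems/MourreKoopmanChargesLinearToEntropyInBandDefs.lean` (namespace `…Theorems.LTEInBand`, opened below). -/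

open Summit.AtomisticToContinuum.HydrodynamicLimit.Theorems.LTEInBand

/-! ## Registered stubs (`sorry` only here) -/

/-- **stub 1 (HARDEST, load-bearing; v2): the LINEAR-TO-VISIBLE-FLUX-GIBBSIANITY UPGRADE.**  The two
typed outputs of the Mourre package — zero Euler-window Drude weight of every one-body field
orthogonal to the collision invariants (`OneBodyCompleteness`, stmt-9583) and strong Euler-scale
mixing of the kinetic shear stress (`StressStrongMixing`, stmt-9584) — imply VISIBLE LOCAL
FLUX-GIBBSIANITY IN PRESSURE FORM (`VisibleFluxGibbsianity`; in band by construction: `∃ σ₀`,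
parameter boxes `σhi < σ₀`).  Intended proof (route header #6 + card local-flux-gibbsianity-ballwise
two-layer plan): duality writes the window pressure as `sup_ν [2·tilt(ν) − s(ν | g_U)]` over locally
invariant finite-entropy states of the infinite dynamics (Kifer-type); zero excess Drude weight of
the projected visible currents — the hypotheses plus their collisional-transfer twins, which at
packing `< σ₀³` are `O(σ₀³)`-perturbations controlled by the cluster expansion of `G_M` — ⇒ invariant
tangent states of vanishing specific entropy carry anomalous current `o(√s)` ⇒ with a second-order
current bound, `limsup ≤ δ` for test fields of sup-norm `≤ β₀`.  Why it might fail (the crux's own):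
equilibrium linear response does not see far-from-equilibrium invariant states — a soft stationary
family inside the dilute band with anomalous current `e ~ s^γ, γ < 1`; the collisional-transfer
currents are NOT covered by the two kinetic hypotheses (refuter's standing objection on 9585).
STRUCTURAL GAPS recorded by lead c4 (census): the hypotheses are typed at EXACT scaling
`ε_N = σ(N+1)^{-1/3}` and drift `u = 0`, the conclusion quantifies over all diameter sequences with
`(M+1)ε_M³ → σ'³` and all drifts `‖u‖ ≤ U` — the drift is removed by the landed Galilean boost machinery
(`KineticWindowGronwallBoost.*`; rung `LTEInBand.stub_oneBodyCompletenessGalilean` LANDED p159187), the ε-generality needs a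
continuity-in-density input the hypotheses do not provide.  PARTIAL RESULTS LANDED (linear shadow):
`LTEInBand.stub_kineticStressLinearRung` (9583 ⟹ 9531), `stub_kineticHeatFluxLinearRung` (9583 ⟹ 9532),
`stub_stressRungOfStrongMixing` (9584 ⟹ 9531).  Size: XL / open-problem.  Leans on: OllaVaradhanYau1993 §3–4,
Spohn1991 Part I §3.3 + §7.1, `Literature.MathematicalPhysics.KineticTheory.hsCompressibility`,
Ruelle1969 (cluster expansion), Kifer1990.  Disproof used: none filed for this crux (2026-08-17). -/
theorem stub_visibleFluxGibbsianity :
    MourreKoopmanCharges.OneBodyCompleteness → MourreKoopmanCharges.StressStrongMixing → VisibleFluxGibbsianity := by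
  sorry

/-- **stub 2: cubic uniform integrability of the energy current, packing-guarded** (guarded weakening
of the shared crux `EnergyCurrentTails` stmt-9235, so 9235 ⇒ this with `η := 1`,
`energyCurrentTailsInBand_of_unguarded`).  Needed for the energy equation in the ball-wise Gronwall AND
(v5) for the window continuity, where it enters GUARDED.  Blocking heads BY NAME (wave 2, landed p154496):
`glue_energyCurrentTailsInBand_of_firstPartner : FirstPartnerFloorMeso → FirstPartnerRealisedShare →
JeansLoadedDice.ContactIntensityDominationOneRare → EnergyCurrentTailsInBand` and
`glue_energyCurrentTailsInBand_of_mixingFloor4L : QuarticMixingFloor4L → ContactIntensityDominationOneRare →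
EnergyCurrentTailsInBand`.  Why plausibly true: local-Gibbs cost of extensive energy concentration is
extensive and the `o(N)` entropy bootstrap excludes it; the open part is cubic mass on a vanishing
fraction of particles.  Size: L / open.  Leans on: NachtergaeleYau2003, OllaVaradhanYau1993 §4.
Disproof used: honours `Cruxes.EnergyCurrentTails.Disproof.energyCurrentTails_false_without_randomness`
(the statement keeps the expectation under the random local Gibbs law). -/
theorem stub_energyCurrentTailsInBand :
    EnergyCurrentTailsInBand := by
  sorry

/-- **stub L (v6; BY NAME): the Lanford envelope at fixed reduced density along the true law** — the staffed
crux `BGEndpointRigidity.LanfordEnvelopeR` (stmt-AtomisticToContinuum-13677, repaired form of 11470: an `N`-uniform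
Gaussian pair-envelope for the volume-marginals of the transported local Gibbs density on the hard-sphere domain, up to
a horizon).  It is the line's SINGLE dynamical a-priori input under the true law and supplies, through LANDED glue:
(a) the guarded fast-collision throughput, v5's stub 3 (`glue_fastCollisionThroughputInBand_of_lanfordEnvelopeR`, p156573;
13677 ⟹ 13022 by `glue_fastCollisionThroughput_of_lanfordEnvelopeR`, p155741); (b) the per-window mean transfer activity and
hence the guarded window continuity (`glue_windowContinuityInBandBelow_of_lanfordEnvelopeR`, p158600, replacing CAT ∧ CEAT /
`TwoClocks.TransferActivityTails` of v5's stub 4b); (c) inside 4a: the per-window invisible-collision throughput (fast part)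
and the time-freeze activity bound (wave-3 audit §2(e1)–(e2)).  Why it might fail (13677's own): energy concentration on few
particles before `T` breaks any fixed envelope (HighMomentumCutoff in marginal form).  Size: L / open.  Leans on: GST2013,
BGSSAnnals2023, `CollisionRate.stub_marginalEnvelopeLG_of_lanfordEnvelopeR` (landed). -/
theorem stub_lanfordEnvelopeR :
    BGEndpointRigidity.LanfordEnvelopeR := by
  sorry

/-- **stub 4a-i (v7; XL — THE ball-wise localisation): visible flux-Gibbsianity gives the VISIBLE ONE-BLOCK ESTIMATE IN
THE BAND.**  `VisibleOneBlockEstimateInBand` (DefsB): along guarded classical solutions and flow families with local Gibbs data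
converging at `t = 0`, for the explicit reference family `ψ_s^N = localGibbs(ρ_s·Rf(σ³ρ_s), u_s, θ_s)` (the `(r, Rf)` prefix of
`WindowClauseInBand` verbatim), `∀ t ∈ (0,T) ∃ β₀ > 0 ∃ K_ov ≥ 0 ∀ fixed smooth test fields of sup ≤ β₀ ∀ δ > 0 ∃ K₀ ∀ K ≥ K₀
∀ R ≥ K₀ ∃ τ₀ ∀ τ ≥ τ₀ ∃ k₀ ∀ k ≥ k₀ ∃ N₀ ∀ N ≥ N₀ ∀ s, s + w ≤ t`: `E_P[w·visCoreN(…)(window at s)] ≤ w·(K_ov·H_N(s) + δ(N+1))`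
(+ integrability), `visCoreN` = the 13021 visible functional transcribed to the `N`-system with LOCAL visibility threshold
`(3/2)ρ_s(xᵢ)` and EOS argument `min(ρ̄, 2ρ_s)σ³`.  Proof plan (AUDIT-4a §3 items 1–4): entropy inequality BALL-WISE on an
`r`-grid against the homogeneous invariant references `G_{M_B}` of the `(M_B+1 = ⌊ρ_B(N+1)⌋)`-sphere closed torus systems read
along the subsequence `M_B(N)` (VLFG's general-`ε` typing is exactly what this needs), via a SPLICE law `μ_B` on the
`M_B`-torus (`BallSplice`, `ballSplice_klDiv_eq`), sub-additivity of the ball marginals' relative entropies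
(`ballMarginal_klDiv_sum_le`: `Σ_B KL(f|_{B⁺} ‖ ψ|_{B⁺}) ≤ C_ov·KL(f‖ψ) + o(N)`, hard-core boundary layers), the frozen-reference
mismatch (`frozenReference_mismatch_le`: `N_B(Cr² + Cr√h_B) + o(N_B)`) and two `L¹` window-locality lemmas with macroscopic
collars (`windowLocality_L1`) — NONE of which exists in the tree.  Why it might fail: the exponential-scale block↔torus
PRESSURE comparison is paper-level FALSE (fixed-amplitude influence locality; Cruxes/CorrectorPressureDecay/LAYER2) — only the
`L¹`/splice route survives; hard-core boundary `o(N_B)` corrections; canonical constraint of the references.  Size: XL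
(crux-sized: promote-stub candidate).  Leans on: Yau1991 §2, OllaVaradhanYau1993 §3, KipnisLandim1999 Ch. 6,
`Literature…StatisticalMechanics.sum_windowRelEntropy_le_biUnion` (Poisson/Euclidean form, needs a torus bridge). -/
theorem stub_visibleOneBlockEstimateInBand :
    VisibleFluxGibbsianity → VisibleOneBlockEstimateInBand := by
  sorry

/-- **stub 4a-ii (v8 = v7 CORRECTED by the sixth antecedent `DenseKineticContentW η`; L–XL — Yau's bookkeeping with the
visible/invisible split): the window clause from the visible one-block estimate and the per-window / per-time true-law inputs.**
v8: pieces LANDED (`stub_windowClausePieces` p168720, `stub_windowClausePricing` p168726); missing lemmas M2 (streaming part of the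
exponent = `visKinN` summand), M3 (`visCollTermN` = frozen pair kernel, torus-segment FTC), M4a (`frozen_split`) typed in the lead's
`work/stubs/WindowClausePlan.lean`; residual risk: quasi-static block coefficients for `(ē−e)·δm̃_{>K'}` via CSCV-W, extended
`MesoscopicBlockLD` (i′) for the energy cross terms.  v7 text:  For every packing level `η > 0`: pathwise on the good set
`−(Str+Col) ≤ β⁻¹ w·visCoreN(β∇λ_{s_j}) + Quad + Invis_kin + Invis_coll + freeze + O(k(N+1)^{-1/3})(N+1)w` (replaces the heart's
`window_domination`; reusable landed pieces: S2 `PathwiseEntropyProduction`, S4 `EosConsistency`, S8's algebra, C0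
`stub_windowBalance`, FZ `freezeBounds`, TM, `window_bookkeeping`); the visible term is priced by 4a-i (Grönwall `K = K_ov·sup‖∇λ‖/β₀`,
fixed before `ε`), the fast kinetic currents by ECT(η), the invisible collisional currents by `InvisibleCollisionThroughputW η`
(pair kernel `≤ C_f ε_N(1+|v⁺+v⁻|/2)|Δv|`), the collision-kernel time-freeze and the test-field time grid by
`MeanWindowTransferActivityBelow η` (linearity of `visCoreN` in the fields), the cubic-in-velocity terms (energy-direction one-block
remainder, energy current of slow-dense particles — not entropy-priceable at an `O(1)` rate, HighMomentumCutoff) by the heart's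
weighted coherence input CSCV-W, and the density/momentum part of the QUADRATIC one-block remainder plus the count of slow-dense
particles by the TRUE-grade statics `MesoscopicBlockLD` (DefsB; registered helper target `stub_mesoscopicBlockLD`, to be landed
`--supports` and used inside — folded here, not an antecedent, to keep the skeleton at seven open stubs).  Why it might fail:
the `K,R`-free rate of `MesoscopicBlockLD`(i) vs the `K,R`-dependent visible fields; window bookkeeping of the `s`-grid.
Size: L–XL.  Leans on: Yau1991 §2, the landed `ClampedCurrentsDock{Pathwise,Eos,Cancellation,HeartFreeze,WindowBalance}` pieces,
`LTEInBand.stub_objectsV7`. -/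
theorem stub_windowClauseOfOneBlockInBand :
    ∀ η : ℝ, 0 < η → VisibleOneBlockEstimateInBand → EnergyCurrentTailsBelow η → InvisibleCollisionThroughputW η → MeanWindowTransferActivityBelow η → DenseKineticContentW η → Summit.AtomisticToContinuum.HydrodynamicLimit.Theorems.HydroLimitInBandOfHeart.CoherentSuprathermalContentVanishesW → Summit.AtomisticToContinuum.HydrodynamicLimit.Theorems.HydroLimitInBandHeart.WindowClauseInBand := by
  sorry

/-- **stub I∧D (v8; TWO bare true-law inputs registered as ONE stub — "no mesoscopic clustering before the shock",
collision-weighted and kinetic): `InvisibleCollisionThroughputInBand ∧ DenseKineticContentInBand`.**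
(I) `InvisibleCollisionThroughputInBand := ∃ η > 0, InvisibleCollisionThroughputW η` (DefsB (a)): the per-window throughput of
collisions with a FAST or mesoscopically DENSE endpoint is `o(1)` — exactly the collisions `visCoreN` drops (v8 audit: every dropped
collision fires the indicator with `K_ICT = K − sup‖u‖`, LANDED `ict_indicator_of_not_visible_pair`); its FAST half follows from the
Lanford envelope (`stub_throughputOfEnvelopeR`, glue `glue_invisibleThroughput_of_fast_and_dense` p168090), its DENSE half does not
(domination-only envelope; worker report: a-priori form = conclusion strength as an input; Grönwall form derivable from 16624 + a
clamped dense-activity window LD under the reference, typed `DenseTransferThroughputGInBand` / `ClampedDenseActivityWindowLD` in the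
lead's `work/stubs/InvisibleThroughputT2_scratch.lean`).  (D) `DenseKineticContentInBand := ∃ η > 0, DenseKineticContentW η`
(DefsC (g)): the per-time `(1+‖v‖²)`-weighted content of the `R`-dense particles is `o(1)` — the sixth antecedent of the corrected
4a-ii.  Both are LLN-type statements at the mesoscopic scale `R(N+1)^{-1/3}` under the TRUE law, implied by the conclusion
(entropy `o(N)`) + `MesoscopicBlockLD` (ii); for the planner to FILE (one or two items, 13734-type).  Size: L / open each. -/
theorem stub_noMesoscopicClusteringInBand :
    InvisibleCollisionThroughputInBand ∧ DenseKineticContentInBand := by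
  sorry

/-- **stub C (v7; BY NAME): the weighted coherent-suprathermal input of the 9133/14680 hearts**,
`HydroLimitInBandOfHeart.CoherentSuprathermalContentVanishesW` (conjecture-grade, one of the six `LineInputs` of line
IdeatorOneSketch; with `R(s,x,s') = s'·𝟙{s' > K⋆²}` its `qbar` is the time-averaged suprathermal cubic current vector, so for
ANY sub-population `|Σ suprathermal energy current| ≤ ‖A₄‖(ε + η·Σcub)(N+1)`).  Needed by 4a-ii for the cubic-in-velocity terms
(objects worker's caveat 2); without it 4a-ii is provable only in D-shape (ε-dependent Grönwall constant, SEET-rate tails,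
re-typed window clause).  Size: L / open (shared). -/
theorem stub_coherentSuprathermalContentW :
    Summit.AtomisticToContinuum.HydrodynamicLimit.Theorems.HydroLimitInBandOfHeart.CoherentSuprathermalContentVanishesW := by
  sorry

/-! ## Proved bookkeeping stubs (sorry-free) -/

/-- **stub 4a-iii (v7, PROVED = landed `LTEInBand.stub_throughputOfEnvelopeR`, p160336 + p162149): what the Lanford envelope
delivers PER WINDOW** — the fast-collision throughput (Gaussian factor of the pair envelope, `∃ K₀ ∀ K ≥ K₀`) and the mean transfer
activity (`C = 4C_e σ³(J₁+J₂)`, τ-free), both at every packing level (the guard is unused). -/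
theorem stub_throughputOfEnvelopeR :
    ∀ η : ℝ, 0 < η → BGEndpointRigidity.LanfordEnvelopeR → FastCollisionThroughputW η ∧ MeanWindowTransferActivityBelow η :=
  Summit.AtomisticToContinuum.HydrodynamicLimit.Theorems.LTEInBand.stub_throughputOfEnvelopeR

/-- **S5 (v8, PROVED): v6's window-clause stub from the v8 pieces** — for `η > 0` descend to `η' := min η (min ηI ηD)` (`ηI`,
`ηD` the levels of stub I∧D) by the antitonicity of ECT, ICT and DKC (`energyCurrentTailsBelow_antitone`,
`invisibleCollisionThroughputW_antitone`, `denseKineticContentW_antitone`), take the visible one-block estimate from 4a-i, the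
mean activity at level `η'` from 4a-iii, CSCV-W by name, and apply the corrected 4a-ii (`WindowClauseInBand` carries its own
packing threshold, so the level of application is immaterial). -/
theorem stub_windowClauseVisibleInBandOfPieces :
    (VisibleFluxGibbsianity → VisibleOneBlockEstimateInBand) →
    (∀ η : ℝ, 0 < η → VisibleOneBlockEstimateInBand → EnergyCurrentTailsBelow η → InvisibleCollisionThroughputW η → MeanWindowTransferActivityBelow η → DenseKineticContentW η → Summit.AtomisticToContinuum.HydrodynamicLimit.Theorems.HydroLimitInBandOfHeart.CoherentSuprathermalContentVanishesW → Summit.AtomisticToContinuum.HydrodynamicLimit.Theorems.HydroLimitInBandHeart.WindowClauseInBand) →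
    (∀ η : ℝ, 0 < η → BGEndpointRigidity.LanfordEnvelopeR → FastCollisionThroughputW η ∧ MeanWindowTransferActivityBelow η) →
    (InvisibleCollisionThroughputInBand ∧ DenseKineticContentInBand) →
    Summit.AtomisticToContinuum.HydrodynamicLimit.Theorems.HydroLimitInBandOfHeart.CoherentSuprathermalContentVanishesW →
    (∀ η : ℝ, 0 < η → VisibleFluxGibbsianity → EnergyCurrentTailsBelow η → BGEndpointRigidity.LanfordEnvelopeR → Summit.AtomisticToContinuum.HydrodynamicLimit.Theorems.HydroLimitInBandHeart.WindowClauseInBand) := by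
  intro h1 h2 h3 hID hC η hη hV hE hL
  obtain ⟨⟨ηI, hηI, hIW⟩, ⟨ηD, hηD, hDW⟩⟩ := hID
  have hη' : 0 < min η (min ηI ηD) := lt_min hη (lt_min hηI hηD)
  have hleI : min η (min ηI ηD) ≤ ηI := (min_le_right _ _).trans (min_le_left _ _)
  have hleD : min η (min ηI ηD) ≤ ηD := (min_le_right _ _).trans (min_le_right _ _)
  exact h2 (min η (min ηI ηD)) hη' (h1 hV) (energyCurrentTailsBelow_antitone (min_le_left _ _) hE)
    (invisibleCollisionThroughputW_antitone hleI hIW) (h3 (min η (min ηI ηD)) hη' hL).2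
    (denseKineticContentW_antitone hleD hDW) hC

/-- **S3 (v6, PROVED): the static clause is landed, so the window clause gives the static one-window ledger** —
`HydroLimitInBandSplit.oneWindowLedgerStatic_of_clauses HydroLimitInBandHeart.stub_staticClause` (cf. the landed v5 form
`LTEInBand.glue_oneWindowLedgerStatic_of_windowClause`, p157001). -/
theorem stub_oneWindowLedgerStaticOfWindowClause :
    (∀ η : ℝ, 0 < η → VisibleFluxGibbsianity → EnergyCurrentTailsBelow η → BGEndpointRigidity.LanfordEnvelopeR → Summit.AtomisticToContinuum.HydrodynamicLimit.Theorems.HydroLimitInBandHeart.WindowClauseInBand) →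
    (∀ η : ℝ, 0 < η → VisibleFluxGibbsianity → EnergyCurrentTailsBelow η → BGEndpointRigidity.LanfordEnvelopeR → Summit.AtomisticToContinuum.HydrodynamicLimit.Theorems.ClampedCurrentsDockFromWindows.OneWindowLedgerStatic) :=
  fun h η hη hV hE hL =>
    Summit.AtomisticToContinuum.HydrodynamicLimit.Theorems.HydroLimitInBandSplit.oneWindowLedgerStatic_of_clauses
      Summit.AtomisticToContinuum.HydrodynamicLimit.Theorems.HydroLimitInBandHeart.stub_staticClause (h η hη hV hE hL)

/-- **S4 (v6, PROVED): the integrated ledger in band from the static one-window ledger and the Lanford envelope** — the landed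
`LTEInBand.glue_ballwiseLedger_of_static_of_lanfordEnvelopeR` (p158600: summation `stub_ledgerFromWindowsS`, a-priori bound
`ledgerAprioriBound`, guarded window continuity from the envelope + the stub's own antecedent ECT(η)); its dummy
`FastCollisionThroughputBelow η` antecedent is fed, at the composition, from the envelope itself (p156573). -/
theorem stub_ballwiseLedgerOfPieces :
    (∀ η : ℝ, 0 < η → VisibleFluxGibbsianity → EnergyCurrentTailsBelow η → BGEndpointRigidity.LanfordEnvelopeR → Summit.AtomisticToContinuum.HydrodynamicLimit.Theorems.ClampedCurrentsDockFromWindows.OneWindowLedgerStatic) →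
    BGEndpointRigidity.LanfordEnvelopeR →
    (∀ η : ℝ, 0 < η → VisibleFluxGibbsianity → EnergyCurrentTailsBelow η → FastCollisionThroughputBelow η → Summit.AtomisticToContinuum.HydrodynamicLimit.Theorems.ClampedCurrentsDockFromWindows.LedgerIntegratedCoreInBand) :=
  fun hS hLan =>
    glue_ballwiseLedger_of_static_of_lanfordEnvelopeR (fun η hη hV hE _ => hS η hη hV hE hLan) hLan

/-- **S2 (PROVED, landed p148932): the integrated ledger gives the guarded Gronwall core** —
`LTEInBand.stub_gronwallCoreOfLedger = HydroLimitInBandOfHeart.gronwallCoreInBand_of_ledger EntropyClockDock.ledgerAprioriBound`. -/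
theorem stub_gronwallCoreOfLedger :
    Summit.AtomisticToContinuum.HydrodynamicLimit.Theorems.ClampedCurrentsDockFromWindows.LedgerIntegratedCoreInBand → Summit.AtomisticToContinuum.HydrodynamicLimit.Theorems.HydroLimitInBandOfHeart.GronwallCoreInBand :=
  Summit.AtomisticToContinuum.HydrodynamicLimit.Theorems.LTEInBand.stub_gronwallCoreOfLedger

/-- **S1 (PROVED, landed p148932): the guarded Gronwall core docks to the route's Yau target** —
`LTEInBand.stub_dockGronwallCoreInBand = EntropyClockDock.relEntropyVanishingInBand_of_gronwallCoreInBand`. -/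
theorem stub_dockGronwallCoreInBand :
    Summit.AtomisticToContinuum.HydrodynamicLimit.Theorems.HydroLimitInBandOfHeart.GronwallCoreInBand → MourreKoopmanCharges.RelEntropyVanishingInBand :=
  Summit.AtomisticToContinuum.HydrodynamicLimit.Theorems.LTEInBand.stub_dockGronwallCoreInBand

/-! ## Composition (sorry-free) -/

/-- **Composition (kernel-checked, NO sorry): the stub STATEMENTS imply the crux**, stated with the crux
unfolded ONE step (`LinearToEntropyInBand` is by definition `OneBodyCompleteness → StressStrongMixing →
RelEntropyVanishingInBand`, see the `rfl` example below).  Proof: the envelope gives the guarded fast-collision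
throughput at some level `η₂` (landed `glue_fastCollisionThroughputInBand_of_lanfordEnvelopeR`); take the level `η₁` of
stub 2, descend both to `η := min η₁ η₂` by antitonicity, feed visible flux-Gibbsianity (stub 1 applied to the crux's two
hypotheses), the guarded tails and the envelope into the window clause (v6's 4a = S5 over 4a-i, 4a-ii, 4a-iii, I, C in v7),
the static clause (S3), the summation with the envelope-driven window continuity (S4), the landed Grönwall (S2) and the dock (S1). -/
theorem LinearToEntropyInBand_of_stubs :
    (MourreKoopmanCharges.OneBodyCompleteness → MourreKoopmanCharges.StressStrongMixing → VisibleFluxGibbsianity) →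
    (EnergyCurrentTailsInBand) →
    (BGEndpointRigidity.LanfordEnvelopeR) →
    (∀ η : ℝ, 0 < η → VisibleFluxGibbsianity → EnergyCurrentTailsBelow η → BGEndpointRigidity.LanfordEnvelopeR → Summit.AtomisticToContinuum.HydrodynamicLimit.Theorems.HydroLimitInBandHeart.WindowClauseInBand) →
    ((∀ η : ℝ, 0 < η → VisibleFluxGibbsianity → EnergyCurrentTailsBelow η → BGEndpointRigidity.LanfordEnvelopeR → Summit.AtomisticToContinuum.HydrodynamicLimit.Theorems.HydroLimitInBandHeart.WindowClauseInBand) →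
      (∀ η : ℝ, 0 < η → VisibleFluxGibbsianity → EnergyCurrentTailsBelow η → BGEndpointRigidity.LanfordEnvelopeR → Summit.AtomisticToContinuum.HydrodynamicLimit.Theorems.ClampedCurrentsDockFromWindows.OneWindowLedgerStatic)) →
    ((∀ η : ℝ, 0 < η → VisibleFluxGibbsianity → EnergyCurrentTailsBelow η → BGEndpointRigidity.LanfordEnvelopeR → Summit.AtomisticToContinuum.HydrodynamicLimit.Theorems.ClampedCurrentsDockFromWindows.OneWindowLedgerStatic) →
      BGEndpointRigidity.LanfordEnvelopeR →
      (∀ η : ℝ, 0 < η → VisibleFluxGibbsianity → EnergyCurrentTailsBelow η → FastCollisionThroughputBelow η → Summit.AtomisticToContinuum.HydrodynamicLimit.Theorems.ClampedCurrentsDockFromWindows.LedgerIntegratedCoreInBand)) →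
    (Summit.AtomisticToContinuum.HydrodynamicLimit.Theorems.ClampedCurrentsDockFromWindows.LedgerIntegratedCoreInBand → Summit.AtomisticToContinuum.HydrodynamicLimit.Theorems.HydroLimitInBandOfHeart.GronwallCoreInBand) →
    (Summit.AtomisticToContinuum.HydrodynamicLimit.Theorems.HydroLimitInBandOfHeart.GronwallCoreInBand → MourreKoopmanCharges.RelEntropyVanishingInBand) →
    (MourreKoopmanCharges.OneBodyCompleteness → MourreKoopmanCharges.StressStrongMixing → MourreKoopmanCharges.RelEntropyVanishingInBand) := by
  intro hL hT hLan hW hS3 hS4 hG hD h₁ h₂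
  obtain ⟨η₁, hη₁, hT₁⟩ := hT
  obtain ⟨η₂, hη₂, hF₂⟩ := glue_fastCollisionThroughputInBand_of_lanfordEnvelopeR hLan
  exact hD (hG (hS4 (hS3 hW) hLan (min η₁ η₂) (lt_min hη₁ hη₂) (hL h₁ h₂)
    (energyCurrentTailsBelow_antitone (min_le_left η₁ η₂) hT₁)
    (fastCollisionThroughputBelow_antitone (min_le_right η₁ η₂) hF₂)))

/-- **REGISTERED SKELETON THEOREM: the crux BY NAME from the declared stubs** (the only `sorryAx` in its
closure enters through the seven open `stub_*`; 4a-iii, S1–S5 and `_of_stubs` are sorry-free; v8 stub set). -/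
theorem LinearToEntropyInBand_of :
    Summit.AtomisticToContinuum.HydrodynamicLimit.Theses.MourreKoopmanCharges.LinearToEntropyInBand :=
  LinearToEntropyInBand_of_stubs stub_visibleFluxGibbsianity stub_energyCurrentTailsInBand
    stub_lanfordEnvelopeR
    (stub_windowClauseVisibleInBandOfPieces stub_visibleOneBlockEstimateInBand stub_windowClauseOfOneBlockInBand
      stub_throughputOfEnvelopeR stub_noMesoscopicClusteringInBand stub_coherentSuprathermalContentW)
    stub_oneWindowLedgerStaticOfWindowClause stub_ballwiseLedgerOfPieces stub_gronwallCoreOfLedger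
    stub_dockGronwallCoreInBand

/-- Sanity: the crux's consequent is literally the shared guarded target (stmt-17396). -/
example : Summit.AtomisticToContinuum.HydrodynamicLimit.Theses.MourreKoopmanCharges.LinearToEntropyInBand =
    (MourreKoopmanCharges.OneBodyCompleteness → MourreKoopmanCharges.StressStrongMixing → MourreKoopmanCharges.RelEntropyVanishingInBand) := rfl

end Summit.AtomisticToContinuum.HydrodynamicLimit.Cruxes.LinearToEntropyInBand.Birth

end
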